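import Literature.Probability.RandomPlanarGeometry.HexSAWBrickWallSlabFugacityConvex
import Literature.Probability.RandomPlanarGeometry.HexSAWBrickWallStripFugacityLevel0Prop6
import Mathlib.Analysis.Convex.Deriv
import HarnessLib

/-!
# Beaton 2014 Proposition 8 for the armchair slabs, the remaining qualitative clauses: `y ↦ μ_H(y,1)` is CONTINUOUS on
# `(0, ∞)`, `μ_H(y',1) ≤ (y'/y) μ_H(y,1)`, and `t ↦ log μ_H(eᵗ,1)` is CONVEX on `ℝ` ("log-convex and thus continuous in `log y`")

Topic `Literature/Probability/RandomPlanarGeometry` (lane «pcv-sawmu», rotated-door lineage, a-p6 g14; rider on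
`HexSAWBrickWallSlabFugacityConvex.lean` — `HexBW.slabMuY_mono_y`, `HexBW.slabZ_holder`, `HexBW.slabMuY_logConvex` (Hölder form,
`0 < θ < 1`) — over `HexSAWBrickWallSlabFugacity.lean` (`HexBW.slabZ H n y = Ĉ_{H,n}(y,1)`, `HexBW.leftVisits_le`, `HexBW.slabZ_pos`,
`HexBW.tendsto_slabZ_rpow`, `HexBW.slabMuY_pos`); the ARMCHAIR twin of `HexSAWBrickWallStripFugacityLevel0Prop6.lean` (a-idea-1 g22,
the zig-zag strips `μ_T(y,1)` of BBdGDCG14 Proposition 6), whose scalar lemma `HexBW.tendsto_rpow_succ_div` is imported, not copied).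

Source.  N. R. Beaton, *The critical surface fugacity of self-avoiding walks on a rotated honeycomb lattice*, J. Phys. A 47 (2014)
075003, arXiv:1210.0274v3, §3.2, Proposition 8 (p. 15; held corpus text `paper:arxiv-1210.0274` chunk 11 ll. 25–31): "where
`μ_T(y,z)` is finite and non-decreasing in `y` and `z`. By the symmetry of bridges, `μ_T(y,z) = μ_T(z,y)`, and so in particular
`μ_T(y,1) = μ_T(1,y)`. Finally, `μ_T(1,y)` is log-convex and thus is a continuous function of `log y`." (Proof, ibid.: "The same
arguments we used for Proposition 7 apply here. The log-convexity result is easily adapted from [vanRensburg2006Selfavoiding]".)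
The device below is the standard one of J. M. Hammersley, G. M. Torrie, S. G. Whittington, J. Phys. A 15 (1982) 539, §2 (term-wise
comparison `Ĉ_{H,n}(y') ≤ (y'/y)^{n+1} Ĉ_{H,n}(y)` for `y ≤ y'`, hence `μ_H(y') ≤ (y'/y) μ_H(y)`; section/equation numbers of HTW82
as reported by the twin file, source not held).

Frame.  `HexBW.slabMuY H y` is Beaton's `μ_T(y,1)` for the strip of the ROTATED lattice realised as the column slab
`Slab_H = {0 ≤ x₀ ≤ H}` of the brick wall with the weight on the column `x₀ = 0` (translation classes, `H ≥ 1`); the printed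
clause is about `μ_T(1,y)`, which equals `μ_T(y,1)` by the printed symmetry — in the tree `HexBW.slabMuY₂_symm` /
`HexBW.slabMuY₂_one_left` of `HexSAWBrickWallSlabFugacityTwoSided.lean` (not imported here; the statements below are literally
about `μ_H(y,1)`).

## What is proved (namespace `Literature.Probability.RandomPlanarGeometry.SAW.HexBW`; `H ≥ 1` throughout)

* `monotoneOn_slabMuY` — `MonotoneOn (slabMuY H) (Ioi 0)` (the tree's `slabMuY_mono_y`, packaged);
* `slabZ_le_ratio_pow_mul` — `Ĉ_{H,n}(y') ≤ (y'/y)^{n+1} Ĉ_{H,n}(y)` for `0 < y ≤ y'` (`leftVisits ≤ n + 1`; the SHARPER parity bound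
  `(y'/y)^{n/2+2}` is the tree's `HexBW.slabZ_le_pow_mul` of `HexSAWBrickWallSlabFugacitySqrtMonotone.lean`, whence `μ_H(y') ≤ √(y'/y) μ_H(y)`
  (`slabMuY_le_sqrt_mul`) — not imported here: its olean is not built at the time of writing, and continuity needs only the linear ratio);
* **`slabMuY_le_div_mul`** — `μ_H(y') ≤ (y'/y) · μ_H(y)` for `0 < y ≤ y'`, i.e. `μ_H(y)/y` is non-increasing (`antitoneOn_slabMuY_div`);
* **`continuousOn_slabMuY`** — `y ↦ μ_H(y)` is continuous on `(0, ∞)` ("and thus is a continuous function"), `continuousAt_slabMuY`;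
* `slabMuY_rpow_mul_rpow_le` — the Hölder inequality of the Convex file on the CLOSED range `0 ≤ θ ≤ 1`;
* **`convexOn_log_slabMuY_exp`** — `t ↦ log μ_H(eᵗ)` is convex on `ℝ` ("log-convex … function of `log y`", as a `ConvexOn` statement),
  `log_slabMuY_rpow_mul_rpow_le`, `continuous_log_slabMuY_exp` ("continuous function of `log y`", literally), and the midpoint form
  `slabMuY_sqrt_mul_sq_le` — `μ_H(√(y₁y₂))² ≤ μ_H(y₁) μ_H(y₂)`.

LABEL (author's proposal): CONSOLIDATION AS PRINTED (XS) — Proposition 8's "continuous" clause for `μ_T(y,1)` was not yet a tree theorem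
(the tree had monotonicity and the Hölder form of log-convexity); armchair twin of the zig-zag file, no new mathematics.
EDITION ed.2 (2026-08-24, a-p6 g14): ed.1 `64fbc86f88aa2018` with the term-wise lemma RENAMED `slabZ_le_pow_mul` → `slabZ_le_ratio_pow_mul`
(the former fully-qualified name is taken by `HexSAWBrickWallSlabFugacitySqrtMonotone.lean`, a different statement; gate dry-run
`dedup.fqn-exists`, 14:15Z) and the two cross-references above added; statements and proofs otherwise byte-identical.
-/

noncomputable section

open Filter Finset
open _root_.Topology
open Literature.Probability.LatticeModels

namespace Literature.Probability.RandomPlanarGeometry.SAW.HexBW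

variable {H : ℕ} {y y₁ y₂ θ : ℝ}

/-! ### Monotonicity, packaged -/

/-- `μ_H(·,1)` is monotone on `(0, ∞)` (`H ≥ 1`). [cite: Beaton2014RotatedHoneycomb, §3.2, Proposition 8 (arXiv:1210.0274v3 p. 15: "non-decreasing in y and z")] -/
theorem monotoneOn_slabMuY (hH : 1 ≤ H) : MonotoneOn (slabMuY H) (Set.Ioi 0) := fun _ hy _ _ hyy' =>
  slabMuY_mono_y hH hy hyy'

/-- `Ĉ_{H,n}(y) ≥ 0` for `y ≥ 0` (a sum of non-negative monomials).
[cite: Beaton2014RotatedHoneycomb, §3.2, Proposition 8 (arXiv:1210.0274v3 p. 15: the partition function Ĉ_{T,n}(y,z)); lane plumbing, not in print] -/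
theorem slabZ_nonneg (H n : ℕ) (hy : 0 ≤ y) : 0 ≤ slabZ H n y := Finset.sum_nonneg fun _ _ => pow_nonneg hy _

/-! ### `μ_H(y') ≤ (y'/y) μ_H(y)` and continuity -/

/-- `Ĉ_{H,n}(y') ≤ (y'/y)^{n+1} Ĉ_{H,n}(y)` for `0 < y ≤ y'` (every placed walk has at most `n + 1` vertices in the weighted column).
[cite: HammersleyTorrieWhittington1982, §2 (2.10)–(2.11); Beaton2014RotatedHoneycomb, §3.2, Proposition 8 (arXiv:1210.0274v3 p. 15)] -/
theorem slabZ_le_ratio_pow_mul (H n : ℕ) (hy : 0 < y) {y' : ℝ} (hyy' : y ≤ y') :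
    slabZ H n y' ≤ (y' / y) ^ (n + 1) * slabZ H n y := by
  have hq : 1 ≤ y' / y := (one_le_div hy).2 hyy'
  rw [slabZ, slabZ, Finset.mul_sum]
  refine Finset.sum_le_sum fun p _ => ?_
  have hb := leftVisits_le p.1 p.2 n
  calc y' ^ leftVisits p.1 p.2 n = (y' / y) ^ leftVisits p.1 p.2 n * y ^ leftVisits p.1 p.2 n := by
        rw [← mul_pow, div_mul_cancel₀ _ hy.ne']
    _ ≤ (y' / y) ^ (n + 1) * y ^ leftVisits p.1 p.2 n :=
        mul_le_mul_of_nonneg_right (pow_le_pow_right₀ hq hb) (pow_nonneg hy.le _)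

/-- **`μ_H(y') ≤ (y'/y) · μ_H(y)` for `0 < y ≤ y'`** (`H ≥ 1`): the surface free energy grows at most linearly in `log y` with slope `1`.
[cite: HammersleyTorrieWhittington1982, §2 (2.11); Beaton2014RotatedHoneycomb, §3.2, Proposition 8 (arXiv:1210.0274v3 p. 15)] -/
theorem slabMuY_le_div_mul (hH : 1 ≤ H) (hy : 0 < y) {y' : ℝ} (hyy' : y ≤ y') :
    slabMuY H y' ≤ y' / y * slabMuY H y := by
  have hy' : 0 < y' := hy.trans_le hyy'
  have hq : 0 < y' / y := div_pos hy' hy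
  refine le_of_tendsto_of_tendsto' (tendsto_slabZ_rpow hH hy') ((tendsto_rpow_succ_div hq).mul (tendsto_slabZ_rpow hH hy))
    fun n => ?_
  have hZ := slabZ_nonneg H n hy.le
  calc slabZ H n y' ^ (1 / (n : ℝ)) ≤ ((y' / y) ^ (n + 1) * slabZ H n y) ^ (1 / (n : ℝ)) :=
        Real.rpow_le_rpow (slabZ_nonneg H n hy'.le) (slabZ_le_ratio_pow_mul H n hy hyy') (by positivity)
    _ = (y' / y) ^ (((n : ℝ) + 1) * (1 / (n : ℝ))) * slabZ H n y ^ (1 / (n : ℝ)) := by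
        rw [Real.mul_rpow (pow_nonneg hq.le _) hZ, Real.rpow_mul hq.le, ← Nat.cast_add_one, Real.rpow_natCast]

/-- **`y ↦ μ_H(y)/y` is non-increasing on `(0, ∞)`** (`H ≥ 1`) — the ratio form of `slabMuY_le_div_mul`.
[cite: HammersleyTorrieWhittington1982, §2 (2.11); Beaton2014RotatedHoneycomb, §3.2, Proposition 8 (arXiv:1210.0274v3 p. 15)] -/
theorem antitoneOn_slabMuY_div (hH : 1 ≤ H) : AntitoneOn (fun y : ℝ => slabMuY H y / y) (Set.Ioi 0) := by
  intro y hy y' _ hyy'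
  have hy0 : (0 : ℝ) < y := hy
  have hy' : 0 < y' := hy0.trans_le hyy'
  have h := slabMuY_le_div_mul hH hy0 hyy'
  rw [div_le_div_iff₀ hy' hy0]
  calc slabMuY H y' * y ≤ y' / y * slabMuY H y * y := mul_le_mul_of_nonneg_right h hy0.le
    _ = slabMuY H y * y' := by field_simp

/-- **`y ↦ μ_H(y)` is continuous on `(0, ∞)`** (`H ≥ 1`; monotone with `μ_H(y)/y` non-increasing).
[cite: Beaton2014RotatedHoneycomb, §3.2, Proposition 8 (arXiv:1210.0274v3 p. 15: "log-convex and thus is a continuous function of log y"); HammersleyTorrieWhittington1982, §2 (2.12)] -/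
theorem continuousOn_slabMuY (hH : 1 ≤ H) : ContinuousOn (slabMuY H) (Set.Ioi 0) := by
  rw [Metric.continuousOn_iff]
  intro y₀ hy₀ ε hε
  have hy₀' : (0 : ℝ) < y₀ := hy₀
  have hM : 0 < slabMuY H y₀ := slabMuY_pos hH hy₀'
  set M := slabMuY H y₀ with hMdef
  have hy0ne : y₀ ≠ 0 := hy₀'.ne'
  have hMne : M ≠ 0 := hM.ne'
  refine ⟨min (y₀ / 2) (ε * y₀ / (4 * M)), lt_min (by linarith) (by positivity), fun y hy hd => ?_⟩
  have hy' : (0 : ℝ) < y := hy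
  have hyne : y ≠ 0 := hy'.ne'
  rw [Real.dist_eq] at hd ⊢
  have hd1 : |y - y₀| < y₀ / 2 := lt_of_lt_of_le hd (min_le_left _ _)
  have hd2 : |y - y₀| < ε * y₀ / (4 * M) := lt_of_lt_of_le hd (min_le_right _ _)
  rw [abs_sub_lt_iff] at hd1 hd2 ⊢
  rcases le_or_gt y₀ y with hle | hlt
  · have h1 := slabMuY_mono_y hH hy₀' hle
    have h2 := slabMuY_le_div_mul hH hy₀' hle
    have e : y / y₀ * M - M = (y - y₀) / y₀ * M := by rw [sub_div, div_self hy0ne]; ring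
    constructor
    · calc slabMuY H y - M ≤ (y - y₀) / y₀ * M := by linarith [h2, e]
        _ ≤ (ε * y₀ / (4 * M)) / y₀ * M := mul_le_mul_of_nonneg_right (div_le_div_of_nonneg_right hd2.1.le hy₀'.le) hM.le
        _ = ε / 4 := by field_simp
        _ < ε := by linarith
    · linarith [h1]
  · have hle := hlt.le
    have h1 := slabMuY_mono_y hH hy' hle
    have h2 := slabMuY_le_div_mul hH hy' hle
    have hy2 : y₀ / 2 < y := by linarith [hd1.2]
    have e : y₀ / y * slabMuY H y - slabMuY H y = (y₀ - y) / y * slabMuY H y := by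
      rw [sub_div, div_self hyne]; ring
    constructor
    · linarith [h1]
    · have h3 : M - slabMuY H y ≤ (y₀ - y) / y * slabMuY H y := by linarith [h2, e]
      have h4 : (y₀ - y) / y * slabMuY H y ≤ (y₀ - y) / y * M :=
        mul_le_mul_of_nonneg_left h1 (div_nonneg (by linarith) hy'.le)
      have h5 : (y₀ - y) / y < ε / (2 * M) := by
        rw [div_lt_iff₀ hy']
        calc y₀ - y < ε * y₀ / (4 * M) := hd2.2
          _ = ε / (2 * M) * (y₀ / 2) := by field_simp; ring
          _ < ε / (2 * M) * y := mul_lt_mul_of_pos_left hy2 (by positivity)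
      calc M - slabMuY H y ≤ (y₀ - y) / y * M := h3.trans h4
        _ < ε / (2 * M) * M := mul_lt_mul_of_pos_right h5 hM
        _ = ε / 2 := by field_simp
        _ < ε := by linarith

/-- Continuity at every `y > 0` (`H ≥ 1`). [cite: Beaton2014RotatedHoneycomb, §3.2, Proposition 8 (arXiv:1210.0274v3 p. 15)] -/
theorem continuousAt_slabMuY (hH : 1 ≤ H) (hy : 0 < y) : ContinuousAt (slabMuY H) y :=
  (continuousOn_slabMuY hH).continuousAt (Ioi_mem_nhds hy)

/-! ### Log-convexity in `log y` as a `ConvexOn` statement -/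

/-- The Hölder inequality of `HexSAWBrickWallSlabFugacityConvex` on the CLOSED range: `μ_H(y₁^θ y₂^{1−θ}) ≤ μ_H(y₁)^θ μ_H(y₂)^{1−θ}`
for `0 ≤ θ ≤ 1` (`H ≥ 1`). [cite: Beaton2014RotatedHoneycomb, §3.2, Proposition 8 (arXiv:1210.0274v3 p. 15: "log-convex")] -/
theorem slabMuY_rpow_mul_rpow_le (hH : 1 ≤ H) (hy₁ : 0 < y₁) (hy₂ : 0 < y₂) (hθ0 : 0 ≤ θ) (hθ1 : θ ≤ 1) :
    slabMuY H (y₁ ^ θ * y₂ ^ (1 - θ)) ≤ slabMuY H y₁ ^ θ * slabMuY H y₂ ^ (1 - θ) := by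
  rcases hθ0.eq_or_lt with rfl | hθ0'
  · simp
  rcases hθ1.eq_or_lt with rfl | hθ1'
  · simp
  exact slabMuY_logConvex hH hy₁ hy₂ hθ0' hθ1'

/-- **Proposition 8, "`μ_T(1,y)` is log-convex … [in] `log y`", for the armchair slabs: `t ↦ log μ_H(eᵗ)` is convex on `ℝ`** (`H ≥ 1`).
[cite: Beaton2014RotatedHoneycomb, §3.2, Proposition 8 (arXiv:1210.0274v3 p. 15: "Finally, μ_T(1,y) is log-convex and thus is a continuous function of log y"); HammersleyTorrieWhittington1982, §2 (2.12)] -/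
theorem convexOn_log_slabMuY_exp (hH : 1 ≤ H) :
    ConvexOn ℝ Set.univ (fun t : ℝ => Real.log (slabMuY H (Real.exp t))) := by
  refine convexOn_iff_forall_pos.2 ⟨convex_univ, fun t₁ _ t₂ _ a b ha hb hab => ?_⟩
  obtain rfl : b = 1 - a := by linarith
  simp only [smul_eq_mul]
  have h1 := Real.exp_pos t₁
  have h2 := Real.exp_pos t₂
  have key := slabMuY_rpow_mul_rpow_le hH h1 h2 ha.le (by linarith)
  have hexp : Real.exp (a * t₁ + (1 - a) * t₂) = Real.exp t₁ ^ a * Real.exp t₂ ^ (1 - a) := by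
    rw [Real.exp_add, mul_comm a, mul_comm (1 - a), Real.exp_mul, Real.exp_mul]
  rw [hexp]
  have hp := fun s : ℝ => slabMuY_pos hH (Real.exp_pos s)
  calc Real.log (slabMuY H (Real.exp t₁ ^ a * Real.exp t₂ ^ (1 - a)))
      ≤ Real.log (slabMuY H (Real.exp t₁) ^ a * slabMuY H (Real.exp t₂) ^ (1 - a)) :=
        Real.log_le_log (slabMuY_pos hH (mul_pos (Real.rpow_pos_of_pos h1 _) (Real.rpow_pos_of_pos h2 _))) key
    _ = a * Real.log (slabMuY H (Real.exp t₁)) + (1 - a) * Real.log (slabMuY H (Real.exp t₂)) := by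
        rw [Real.log_mul (Real.rpow_pos_of_pos (hp t₁) _).ne' (Real.rpow_pos_of_pos (hp t₂) _).ne',
          Real.log_rpow (hp t₁), Real.log_rpow (hp t₂)]

/-- The same convexity read on `(0,∞)` in the variable `u = log y`: for `0 < y₁, y₂` and `0 ≤ θ ≤ 1`,
`log μ_H(y₁^θ y₂^{1-θ}) ≤ θ log μ_H(y₁) + (1-θ) log μ_H(y₂)` (`H ≥ 1`).
[cite: Beaton2014RotatedHoneycomb, §3.2, Proposition 8 (arXiv:1210.0274v3 p. 15)] -/
theorem log_slabMuY_rpow_mul_rpow_le (hH : 1 ≤ H) (hy₁ : 0 < y₁) (hy₂ : 0 < y₂) (hθ0 : 0 ≤ θ) (hθ1 : θ ≤ 1) :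
    Real.log (slabMuY H (y₁ ^ θ * y₂ ^ (1 - θ))) ≤
      θ * Real.log (slabMuY H y₁) + (1 - θ) * Real.log (slabMuY H y₂) := by
  have hz : 0 < y₁ ^ θ * y₂ ^ (1 - θ) := mul_pos (Real.rpow_pos_of_pos hy₁ _) (Real.rpow_pos_of_pos hy₂ _)
  have hp₁ := slabMuY_pos hH hy₁
  have hp₂ := slabMuY_pos hH hy₂
  calc Real.log (slabMuY H (y₁ ^ θ * y₂ ^ (1 - θ)))
      ≤ Real.log (slabMuY H y₁ ^ θ * slabMuY H y₂ ^ (1 - θ)) :=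
        Real.log_le_log (slabMuY_pos hH hz) (slabMuY_rpow_mul_rpow_le hH hy₁ hy₂ hθ0 hθ1)
    _ = θ * Real.log (slabMuY H y₁) + (1 - θ) * Real.log (slabMuY H y₂) := by
        rw [Real.log_mul (Real.rpow_pos_of_pos hp₁ _).ne' (Real.rpow_pos_of_pos hp₂ _).ne', Real.log_rpow hp₁,
          Real.log_rpow hp₂]

/-- **"a continuous function of `log y`", literally**: `t ↦ log μ_H(eᵗ)` is continuous on `ℝ` (`H ≥ 1`).
[cite: Beaton2014RotatedHoneycomb, §3.2, Proposition 8 (arXiv:1210.0274v3 p. 15: "and thus is a continuous function of log y")] -/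
theorem continuous_log_slabMuY_exp (hH : 1 ≤ H) : Continuous (fun t : ℝ => Real.log (slabMuY H (Real.exp t))) := by
  refine continuous_iff_continuousAt.2 fun t => ?_
  have hpos : 0 < slabMuY H (Real.exp t) := slabMuY_pos hH (Real.exp_pos t)
  have hc : ContinuousAt (fun t : ℝ => slabMuY H (Real.exp t)) t :=
    (continuousAt_slabMuY hH (Real.exp_pos t)).comp Real.continuous_exp.continuousAt
  exact hc.log hpos.ne'

/-- **Midpoint log-convexity**: `μ_H(√(y₁y₂))² ≤ μ_H(y₁) · μ_H(y₂)` for `0 < y₁, y₂` (`H ≥ 1`; the case `θ = ½`).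
[cite: Beaton2014RotatedHoneycomb, §3.2, Proposition 8 (arXiv:1210.0274v3 p. 15: "log-convex"); HammersleyTorrieWhittington1982, §2 (2.12)] -/
theorem slabMuY_sqrt_mul_sq_le (hH : 1 ≤ H) (hy₁ : 0 < y₁) (hy₂ : 0 < y₂) :
    slabMuY H (Real.sqrt (y₁ * y₂)) ^ 2 ≤ slabMuY H y₁ * slabMuY H y₂ := by
  have h := slabMuY_rpow_mul_rpow_le hH hy₁ hy₂ (θ := 1 / 2) (by norm_num) (by norm_num)
  have e : y₁ ^ (1 / 2 : ℝ) * y₂ ^ (1 - 1 / 2 : ℝ) = Real.sqrt (y₁ * y₂) := by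
    rw [show (1 - 1 / 2 : ℝ) = 1 / 2 by norm_num, ← Real.mul_rpow hy₁.le hy₂.le, ← Real.sqrt_eq_rpow]
  rw [e, show (1 - 1 / 2 : ℝ) = 1 / 2 by norm_num] at h
  have hp₁ := slabMuY_pos hH hy₁
  have hp₂ := slabMuY_pos hH hy₂
  have hs : 0 ≤ slabMuY H (Real.sqrt (y₁ * y₂)) := (slabMuY_pos hH (Real.sqrt_pos.2 (mul_pos hy₁ hy₂))).le
  calc slabMuY H (Real.sqrt (y₁ * y₂)) ^ 2 ≤ (slabMuY H y₁ ^ (1 / 2 : ℝ) * slabMuY H y₂ ^ (1 / 2 : ℝ)) ^ 2 :=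
        pow_le_pow_left₀ hs h 2
    _ = slabMuY H y₁ * slabMuY H y₂ := by
        rw [mul_pow, ← Real.rpow_natCast (slabMuY H y₁ ^ (1 / 2 : ℝ)) 2, ← Real.rpow_natCast (slabMuY H y₂ ^ (1 / 2 : ℝ)) 2,
          ← Real.rpow_mul hp₁.le, ← Real.rpow_mul hp₂.le]
        norm_num

end Literature.Probability.RandomPlanarGeometry.SAW.HexBW
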